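import Summits.Ventures.HSemireg.Pad4TowerPhaseTorus

/-!
# Venture HSemireg — PAD-4 on 𝔅(μ₄): the ROOT CELL `⟨Δ²⟩` — `Δ² = (−1,−1,−1,−1)` flips every `β`, twists the class tensor by
# `(−1)^{n_e+n_ē}`, so on EVERY design invariant under a non-trivial clean phase symmetry the 640 mixed (A1)-rows with `n_e + n_ē` odd
# vanish identically; `⟨Δ²⟩`-averaging (μ ↦ 2μ) and `⟨Δ²⟩×S₄`-averaging (μ ↦ 48μ) are WLOG; the γ-windows keep 198 ∕ kill 840 rows
# (IDEATOR LINE 4 ∕ RESULT 15 (2)(4) ∕ row W14b, kernel form)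

HONEST FRAMING. Lean index of the computation cell `pub-hsemireg` (S4-PUSH, H2 door PAD-4), typed by the Ventures-side typer
`hodge-lit-semireg-typer-2` (g5; line of record stmt-HodgeConjecture-18881 `Cruxes/BlochSeedDiscOne/Lines/birth.lean` 814a6a70c14e831a,
stub `stub_rung_pad4_seedAt`, screen (H1) = the class condition (A1)). Ninth file of the KERNEL LEMMA Ψ ⊂ (A1) set; sequel of
`Pad4TowerPhaseTorus` (the phase torus `(ℤ∕4)⁴`, `MCell.phase`, `ch_phase`, the clean lattice: six clean subgroups, `Δ²` in every
non-trivial one). THIS FILE types what bc5-plan g6 IDEATOR LINE 4 (cell INBOX l.32037; card v4.15 96eae72e810e9d81 row W14c (d)) asks of the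
kernel — «kernel form = `g1Invariant_wlog` with ⟨Δ²⟩ in place of ⟨Δ⟩, μ ↦ 2μ resp. 48μ», «640 of the 1 038 mixed (A1) word-rows already forced
to zero by Δ²-invariance alone», «a support closed under ANY non-trivial clean phase symmetry … is ⟨Δ²⟩-closed» — together with gs-eng-2 g51
RESULT 15 (l.32053) (2) «a word picks up (−1)^{n_e+n_ē} (β ↦ −β in both e and ē slots) ⇒ of the 1 038 mixed rows the 512 + 128 = 640 with
n_e+n_ē odd vanish identically, 384 + 14 = 398 survive» and (4) «Screen aggregation for ⟨Δ²⟩×S₄: Σ_{Z∈o} T_Z[w] = [n_e+n_ē even]·(|o|∕|W|)·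
Σ_{w′∈S₄w} T_R[w′] — the v19 rule with rotations {0,2} and the parity test», and the class algebra of the three γ-WINDOWS of card row W14b
(«on γ-invariant designs an (A1)-word survives iff (n_e − n_ē)₁₂ ≡ (n_e − n_ē)₃₄ (mod 4): 198 of the 1 038 mixed rows survive (70 of them
Hermitian — a DIFFERENT 198 from Δ's), 840 vanish identically, the same 6 (2e,2ē) FC rows survive»; gamma_counts.py 26935a2ec1c3f1de).

CONTENT (all PROVED; no `sorry`; axioms standard).
* §1 GENERAL PHASE-INVARIANT VANISHING. `PhaseClosed η S`, `image_phase_eq`, `sum_phase_reindex`; **`MConfig.wch_eq_zero_of_phaseInvariant`**: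
  on an `η`-closed support with `η`-invariant weights, `wch(w) = twistT η w · wch(w)`, hence `wch(w) = 0` at every word with `twistT η w ≠ 1`
  — for EVERY weighted design and EVERY `η ∈ (ℤ∕4)⁴` (generalises `Pad4TowerDeltaWindow.wch_eq_zero_of_deltaInvariant`).
* §2 `Δ²`. **`MCell.delta2 := phase d2Vec`**, `delta2_apply` (`β ↦ −β`), `delta2_eq_delta_delta`, `delta2_delta2`, `delta2_injective`,
  `delta2_perm` (commutes with S₄), `delta2_phase` (commutes with the torus); `neInd`, **`neCount w = n_e + n_ē`**, `gI_sq`, `twistT_d2Vec`,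
  **`MCell.ch_delta2`: `ch(Δ²Z)(w) = (−1)^{n_e+n_ē} · ch(Z)(w)`**; `negOnePow_neCount_ne_one_iff` (odd); **`mixed_d2_count`** (`decide`):
  1 038 mixed words, 640 with `n_e+n_ē` odd (512 with `n_e+n_ē = 1`, 128 with `3`), 398 even (384 with `2`, 14 with `4`).
* §3 `⟨Δ²⟩`-AVERAGING IS WLOG (μ ↦ 2μ). `D2Closed`, `DeltaClosed.d2Closed`, `PhaseClosed.d2Closed_of_gVec`; `MConfig.wch_comp_d2`
  (transport by the involution Δ² twists by `(−1)^{n_e+n_ē}`), **`MConfig.wch_eq_zero_of_d2Invariant`** (the 640 odd rows vanish), `d2Avg m =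
  m + m∘Δ²`, `d2Avg_delta2`, `d2Avg_pos`, `MConfig.wch_d2Avg`, **`MConfig.classScreen_d2Avg`**, **`MConfig.wch_d2Avg_eWord`** (`× 2`),
  **`MConfig.d2Invariant_wlog`**.
* §4 DOMINANCE AT DESIGN LEVEL. `d2Invariant_of_deltaInvariant`, `d2Invariant_of_gammaInvariant` (γ_j² = Δ²), **`d2Invariant_of_cleanInvariant`**
  (weights invariant under a clean subgroup `H ≠ {1}` are Δ²-invariant — via `d2Sub_subset_of_cleanSub`), **`MConfig.wch_eq_zero_of_cleanInvariant`**: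
  on a support closed under a non-trivial clean subgroup with invariant weights, EVERY word with `n_e + n_ē` odd has `wch = 0` — LINE 4's «640
  rows pre-paid» for rows W14 (Δ), W14b (γ), W14c, W14d (Δ×S₄) alike.
* §5 `⟨Δ²⟩ × S₄` (μ ↦ 48μ). `d2Avg_permInvariant`, `d2S4Avg = d2Avg ∘ permAvg`, **`MConfig.wch_d2S4Avg_eWord`** (`× 48`),
  **`MConfig.d2S4Invariant_wlog`**; **`groupSum_d2S4`** (RESULT 15 (4), group-sum form): `Σ_σ (ch(σ·R) + ch(Δ²σ·R))(w) = (1 + (−1)^{n_e+n_ē}) ·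
  Σ_σ ch(R)(σ·w)`.
* §6 THE γ-WINDOWS (row W14b). `texp_gVec0` (`γ₁` twists by `i^{(n_e−n_ē)₀₁ + 3(n_e−n_ē)₂₃}`), **`mixed_gamma_count`** (`decide`, all three γ_j):
  of the 1 038 mixed words 840 are γ_j-twisted, 198 not, 70 of those Hermitian; of the 14 pure e∕ē words exactly the 6 `(2e,2ē)` words are
  untwisted by γ_j AND by Δ; **`MConfig.wch_eq_zero_of_gammaInvariant`** (instance of §1).
* §7 probes (`decide`).

PRECISION. As in `Pad4TowerDeltaWindow` (s4-ref g85 P1 there): the odd rows may be dropped ONLY for Δ²-INVARIANT weights on a Δ²-closed support;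
`d2Invariant_wlog` ∕ `d2Invariant_of_cleanInvariant` are the licences to pass to such weights. RESULT 15 (4)'s orbit normalisation `|o|∕|W|` is
encoder bookkeeping between orbit sums and the group sums typed here (an orbit sum is the group sum divided by the stabiliser order); not retyped.

WHAT IS NOT HERE ∕ NOT IN LEAN. FC-CORE on the Δ² cells (RESULT 15 (3): parity patterns preserved, ≥ 8 FC Δ²-orbits; kernel rows 843 ∕ 872 are
gs-eng-2's), Burnside counts (614 912 ∕ 31 698 …), encoders, any SAT verdict, the (H1) LP. Typing these premises authorises no compute
(director-hodge g12 l.32075: LINE 4 not authorised tonight). The identification of the frame with `H^{ev}(S⁴)` stays the cell's pencil modelling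
sentence. No variety, sheaf, σ, seed or abelian variety; NOTHING HERE SAYS THAT HC ∕ HC_CM ∕ HC_AV ∕ W₆ ∕ HC_Kum4Type HOLDS OR FAILS. No
`instance`, no notation, no named fact, 0 `sorry`.

SOURCES (sha16 ∕ bus): bc5-plan g6 IDEATOR LINE 4 l.32037, LINE 3 l.31806, card v4.15 96eae72e810e9d81 rows W14b ∕ W14c; gs-eng-2 g51 RESULT 15
l.32053; torus_windows.py aed8ecb1cabf8a65 («mixed (A1)-rows killed by the total flip (2,2,2,2) alone: 640 of 1038 | surviving 398»); gamma_counts.py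
26935a2ec1c3f1de + .out.txt («gamma (i,i,-i,-i): mixed rows surviving 198 of 1038 (of which Hermitian 70); FC pure-e rows surviving 6 of 14»);
tree `Pad4TowerPhaseTorus.lean` (this seat), `Pad4TowerPermWindow.lean` 28becaea892846f5 (p605333), `Pad4TowerDeltaWindow.lean` 85a2925c82a6c0e4 (p601410).
-/

namespace Summit.Ventures.HSemireg.Pad4Tower

open Finset

/-! ## §1 Phase-closed supports: an invariant design has `wch(w) = 0` wherever the twist is not `1` -/

/-- a finite set of cells is CLOSED under the phase vector `η`. -/
abbrev PhaseClosed (η : PVec) (S : Finset MCell) : Prop := ∀ Z ∈ S, Z.phase η ∈ S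

/-- on an `η`-closed finite set `η` acts as a permutation: its image is the whole set. -/
theorem image_phase_eq (η : PVec) (S : Finset MCell) (hS : PhaseClosed η S) : S.image (MCell.phase η) = S := by
  apply Finset.eq_of_subset_of_card_le
  · intro x hx
    obtain ⟨Z, hZ, rfl⟩ := Finset.mem_image.1 hx
    exact hS Z hZ
  · rw [Finset.card_image_of_injective _ (MCell.phase_injective η)]

/-- REINDEXING by `η` on an `η`-closed set: `Σ_{Z ∈ S} g(η·Z) = Σ_{Z ∈ S} g(Z)`. -/
theorem sum_phase_reindex {M : Type*} [AddCommMonoid M] (η : PVec) (S : Finset MCell) (hS : PhaseClosed η S) (g : MCell → M) :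
    ∑ Z ∈ S, g (Z.phase η) = ∑ Z ∈ S, g Z := by
  conv_rhs => rw [← image_phase_eq η S hS]
  rw [Finset.sum_image fun Z _ Z' _ h => MCell.phase_injective η h]

/-- **AN `η`-INVARIANT DESIGN HAS `wch(w) = 0` WHEREVER `twistT η w ≠ 1`**: on an `η`-closed support with `η`-invariant weights the weighted
class tensor satisfies `wch(w) = twistT η w · wch(w)` (reindex `Z ↦ η·Z`, `ch_phase`), so it vanishes at every twisted word — for EVERY
weighted design ((A1) or not) and EVERY `η ∈ (ℤ∕4)⁴`. -/
theorem MConfig.wch_eq_zero_of_phaseInvariant (η : PVec) (C : MConfig) (hl : PhaseClosed η C.lower) (hu : PhaseClosed η C.upper)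
    (mN mP : MCell → ℤ) (hN : ∀ Z, mN (Z.phase η) = mN Z) (hP : ∀ P, mP (P.phase η) = mP P) (w : CWord) (hw : twistT η w ≠ 1) :
    C.wch mN mP w = 0 := by
  have key : ∀ (S : Finset MCell), PhaseClosed η S → ∀ m : MCell → ℤ, (∀ Z, m (Z.phase η) = m Z) →
      (∑ Z ∈ S, m Z • Z.ch) w = twistT η w * (∑ Z ∈ S, m Z • Z.ch) w := by
    intro S hS m hm
    have r := sum_phase_reindex η S hS (fun Z => m Z • Z.ch)
    simp only [hm] at r
    conv_lhs => rw [← r]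
    simp only [Finset.sum_apply, Pi.smul_apply]
    simp only [zsmul_eq_mul, MCell.ch_phase, Finset.mul_sum]
    exact Finset.sum_congr rfl fun Z _ => by ring
  have h : C.wch mN mP w = twistT η w * C.wch mN mP w := by
    have e : C.wch mN mP w = (∑ Z ∈ C.lower, mN Z • Z.ch) w - (∑ P ∈ C.upper, mP P • P.ch) w := by
      simp only [MConfig.wch, Pi.sub_apply]
    rw [e, mul_sub, ← key C.lower hl mN hN, ← key C.upper hu mP hP]
  have h1 : (twistT η w - 1) * C.wch mN mP w = 0 := by linear_combination (-1 : GaussianInt) * h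
  rcases mul_eq_zero.1 h1 with h2 | h2
  · exact absurd (sub_eq_zero.1 h2) hw
  · exact h2

/-! ## §2 `Δ²`: the total sign flip and its twist `(−1)^{n_e + n_ē}` -/

/-- **`Δ² = (−1,−1,−1,−1)`**: the phase vector `(2,2,2,2)` acting on cells — `β_f ↦ −β_f` on every factor. -/
def MCell.delta2 (Z : MCell) : MCell := Z.phase d2Vec

/-- `Δ²` flips the sign of every `β`: `(α, Re β, Im β) ↦ (α, −Re β, −Im β)`. -/
theorem MCell.delta2_apply (Z : MCell) (f : Fin 4) : Z.delta2 f = ((Z f).1, -(Z f).2.1, -(Z f).2.2) := by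
  have h : ∀ g : Fin 4, d2Vec g = 2 := by decide
  show phasePt (d2Vec f) (Z f) = _
  rw [h]
  rfl

/-- `Δ² = Δ ∘ Δ`. -/
theorem MCell.delta2_eq_delta_delta (Z : MCell) : Z.delta2 = Z.delta.delta := by
  rw [MCell.delta2, show d2Vec = dVec + dVec by decide, MCell.phase_add, MCell.phase_dVec, MCell.phase_dVec]

/-- `Δ²` is an involution. -/
theorem MCell.delta2_delta2 (Z : MCell) : Z.delta2.delta2 = Z := by
  funext f
  simp [MCell.delta2_apply]

/-- `Δ²` is injective. -/
theorem MCell.delta2_injective : Function.Injective MCell.delta2 := MCell.phase_injective d2Vec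

/-- `Δ²` COMMUTES with every factor permutation (it is S₄-fixed in the torus). -/
theorem MCell.delta2_perm (σ : Equiv.Perm (Fin 4)) (Z : MCell) : (Z.perm σ).delta2 = Z.delta2.perm σ := by
  rw [MCell.delta2, MCell.delta2, MCell.perm_phase, (gVec_conjugate.2.2 σ).2]

/-- `Δ²` commutes with every phase vector. -/
theorem MCell.delta2_phase (η : PVec) (Z : MCell) : (Z.phase η).delta2 = Z.delta2.phase η := by
  rw [MCell.delta2, MCell.delta2, ← MCell.phase_add, ← MCell.phase_add, add_comm]

/-- the indicator of the letters `e`, `ē`. -/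
def neInd : Fin 6 → ℕ := ![0, 0, 0, 1, 1, 0]

/-- **`n_e + n_ē`** of a word: the number of factors carrying `e` or `ē`. -/
def neCount (w : CWord) : ℕ := neInd (w 0) + neInd (w 1) + neInd (w 2) + neInd (w 3)

/-- `i² = −1`. [`decide`] -/
theorem gI_sq : gI ^ 2 = -1 := by decide

/-- the twist exponent of `Δ²` is twice `Pad4TowerDeltaWindow.wtwExp`, which has the parity of `n_e + n_ē`. -/
theorem texp_d2Vec (w : CWord) : texp d2Vec w = 2 * wtwExp w ∧ wtwExp w % 2 = neCount w % 2 := by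
  have h : ∀ g : Fin 4, (d2Vec g).val = 2 := by decide
  have p : ∀ l : Fin 6, twExp l % 2 = neInd l % 2 := by decide
  have p0 := p (w 0); have p1 := p (w 1); have p2 := p (w 2); have p3 := p (w 3)
  refine ⟨by simp only [texp, wtwExp, h]; ring, ?_⟩
  unfold wtwExp neCount
  omega

/-- `Δ²` twists a word by `(−1)^{n_e + n_ē}`. -/
theorem twistT_d2Vec (w : CWord) : twistT d2Vec w = (-1) ^ neCount w := by
  obtain ⟨h1, h2⟩ := texp_d2Vec w
  rw [twistT, h1, pow_mul, gI_sq, neg_one_pow_eq_pow_mod_two, h2, ← neg_one_pow_eq_pow_mod_two]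

/-- **`Δ²` TWISTS THE CLASS TENSOR BY `(−1)^{n_e + n_ē}`** (RESULT 15 (2): «a word picks up (−1)^{n_e+n_ē} (β ↦ −β in both e and ē slots)»). -/
theorem MCell.ch_delta2 (Z : MCell) (w : CWord) : Z.delta2.ch w = (-1) ^ neCount w * Z.ch w := by
  rw [MCell.delta2, MCell.ch_phase, twistT_d2Vec]

/-- the sign `(−1)^{n_e+n_ē}` is `≠ 1` exactly when `n_e + n_ē` is odd. -/
theorem negOnePow_neCount_ne_one_iff (w : CWord) : ((-1 : GaussianInt) ^ neCount w ≠ 1) ↔ neCount w % 2 = 1 := by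
  rw [neg_one_pow_eq_pow_mod_two]
  rcases Nat.mod_two_eq_zero_or_one (neCount w) with h | h <;> rw [h] <;> decide

/-- **THE 640 ∕ 398 SPLIT** (RESULT 15 (2); torus_windows.out «mixed (A1)-rows killed by the total flip (2,2,2,2) alone: 640 of 1038 | surviving
398»): of the 1 038 e-mixed words other than `eeee`, `ēēēē`, exactly 640 have `n_e + n_ē` odd (512 with `n_e+n_ē = 1`, 128 with `3`) and 398
even (384 with `2`, 14 with `4`). [kernel, `decide`] -/
theorem mixed_d2_count :
    (univ.filter fun w : CWord => ¬ EFree w ∧ w ≠ eWord ∧ w ≠ ebarWord).card = 1038 ∧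
    (univ.filter fun w : CWord => ¬ EFree w ∧ w ≠ eWord ∧ w ≠ ebarWord ∧ neCount w % 2 = 1).card = 640 ∧
    (univ.filter fun w : CWord => ¬ EFree w ∧ w ≠ eWord ∧ w ≠ ebarWord ∧ neCount w = 1).card = 512 ∧
    (univ.filter fun w : CWord => ¬ EFree w ∧ w ≠ eWord ∧ w ≠ ebarWord ∧ neCount w = 3).card = 128 ∧
    (univ.filter fun w : CWord => ¬ EFree w ∧ w ≠ eWord ∧ w ≠ ebarWord ∧ neCount w = 2).card = 384 ∧
    (univ.filter fun w : CWord => ¬ EFree w ∧ w ≠ eWord ∧ w ≠ ebarWord ∧ neCount w = 4).card = 14 := by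
  refine ⟨?_, ?_, ?_, ?_, ?_, ?_⟩ <;> decide +kernel

/-! ## §3 `⟨Δ²⟩`-closed supports; `⟨Δ²⟩`-averaging (×2) is WLOG -/

/-- a finite set of cells is Δ²-CLOSED. -/
abbrev D2Closed (S : Finset MCell) : Prop := ∀ Z ∈ S, Z.delta2 ∈ S

/-- a Δ-closed set is Δ²-closed (row W14's supports are root-cell supports). -/
theorem DeltaClosed.d2Closed {S : Finset MCell} (hS : DeltaClosed S) : D2Closed S := fun Z hZ => by
  rw [MCell.delta2_eq_delta_delta]
  exact (hS.iter Z hZ).1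

/-- a γ_j-closed set is Δ²-closed (`γ_j² = Δ²`; row W14b's supports are root-cell supports). -/
theorem PhaseClosed.d2Closed_of_gVec {S : Finset MCell} (j : Fin 3) (hS : PhaseClosed (gVec j) S) : D2Closed S := fun Z hZ => by
  rw [MCell.delta2, ← torus_probes.1 j, MCell.phase_add]
  exact hS _ (hS Z hZ)

/-- transporting the weights by the involution `Δ²` twists the weighted tensor by `(−1)^{n_e+n_ē}` (substitute `Z = Δ²x`). -/
theorem MConfig.wch_comp_d2 (C : MConfig) (hl : D2Closed C.lower) (hu : D2Closed C.upper) (mN mP : MCell → ℤ) (w : CWord) :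
    C.wch (fun Z => mN Z.delta2) (fun P => mP P.delta2) w = (-1) ^ neCount w * C.wch mN mP w := by
  have key : ∀ (S : Finset MCell), D2Closed S → ∀ m : MCell → ℤ,
      (∑ Z ∈ S, m Z.delta2 • Z.ch) w = (-1) ^ neCount w * (∑ Z ∈ S, m Z • Z.ch) w := by
    intro S hS m
    have r : ∑ Z ∈ S, m Z.delta2.delta2 • Z.delta2.ch = ∑ Z ∈ S, m Z.delta2 • Z.ch :=
      sum_phase_reindex d2Vec S hS (fun Z => m Z.delta2 • Z.ch)
    simp only [MCell.delta2_delta2] at r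
    rw [← r]
    simp only [Finset.sum_apply, Pi.smul_apply]
    simp only [zsmul_eq_mul, MCell.ch_delta2, Finset.mul_sum]
    exact Finset.sum_congr rfl fun Z _ => by ring
  simp only [MConfig.wch, Pi.sub_apply, key C.lower hl mN, key C.upper hu mP]
  ring

/-- **A Δ²-INVARIANT DESIGN HAS EVERY ODD WORD VANISH** (LINE 4: «640 of the 1 038 mixed (A1) word-rows already forced to zero by
Δ²-invariance alone»): on a Δ²-closed support with Δ²-invariant weights, `wch(w) = 0` at every word with `n_e + n_ē` odd — for EVERY design. -/
theorem MConfig.wch_eq_zero_of_d2Invariant (C : MConfig) (hl : D2Closed C.lower) (hu : D2Closed C.upper) (mN mP : MCell → ℤ)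
    (hN : ∀ Z, mN Z.delta2 = mN Z) (hP : ∀ P, mP P.delta2 = mP P) (w : CWord) (hw : neCount w % 2 = 1) : C.wch mN mP w = 0 :=
  C.wch_eq_zero_of_phaseInvariant d2Vec hl hu mN mP hN hP w (by rw [twistT_d2Vec]; exact (negOnePow_neCount_ne_one_iff w).2 hw)

/-- the Δ²-AVERAGE (×2) of a weight function: `m(Z) + m(Δ²Z)`. -/
def d2Avg (m : MCell → ℤ) (Z : MCell) : ℤ := m Z + m Z.delta2

/-- the Δ²-average is Δ²-invariant. -/
theorem d2Avg_delta2 (m : MCell → ℤ) (Z : MCell) : d2Avg m Z.delta2 = d2Avg m Z := by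
  simp only [d2Avg, MCell.delta2_delta2]
  ring

/-- the Δ²-average of positive weights on a Δ²-closed support is positive there. -/
theorem d2Avg_pos {S : Finset MCell} (hS : D2Closed S) {m : MCell → ℤ} (hm : ∀ Z ∈ S, 0 < m Z) (Z : MCell) (hZ : Z ∈ S) :
    0 < d2Avg m Z := by
  have h0 := hm Z hZ; have h1 := hm _ (hS Z hZ)
  unfold d2Avg; omega

/-- the weighted tensor of the Δ²-averaged design. -/
theorem MConfig.wch_d2Avg (C : MConfig) (mN mP : MCell → ℤ) :
    C.wch (d2Avg mN) (d2Avg mP) = C.wch mN mP + C.wch (fun Z => mN Z.delta2) (fun P => mP P.delta2) := by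
  simp only [MConfig.wch, d2Avg, add_smul, Finset.sum_add_distrib]
  abel

/-- **Δ²-AVERAGING PRESERVES (A1)** (the screen is Δ²-stable: `(−1)^{n_e+n_ē} = 1` on e-free words). -/
theorem MConfig.classScreen_d2Avg (C : MConfig) (hl : D2Closed C.lower) (hu : D2Closed C.upper) (mN mP : MCell → ℤ)
    (h : ClassScreen (C.wch mN mP)) : ClassScreen (C.wch (d2Avg mN) (d2Avg mP)) := by
  have t : C.wch (fun Z => mN Z.delta2) (fun P => mP P.delta2) = fun w => (-1) ^ neCount w * C.wch mN mP w :=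
    funext fun w => C.wch_comp_d2 hl hu mN mP w
  rw [C.wch_d2Avg, t]
  refine classScreen_add h (classScreen_mul_of_eFree_one _ _ (fun w hw => ?_) h)
  have h0 : ∀ f, neInd (w f) = 0 := fun f => by
    obtain ⟨h3, h4⟩ := hw f
    generalize w f = l at h3 h4
    fin_cases l <;> simp_all [neInd]
  simp [neCount, h0]

/-- **Δ²-AVERAGING DOUBLES THE μ-WORD** (`n_e + n_ē = 4` at `eeee`: `Δ²·eeee = eeee`). -/
theorem MConfig.wch_d2Avg_eWord (C : MConfig) (hl : D2Closed C.lower) (hu : D2Closed C.upper) (mN mP : MCell → ℤ) :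
    C.wch (d2Avg mN) (d2Avg mP) eWord = 2 * C.wch mN mP eWord := by
  have e : neCount eWord = 4 := by decide
  rw [C.wch_d2Avg, Pi.add_apply, C.wch_comp_d2 hl hu, e]
  ring

/-- **`⟨Δ²⟩`-AVERAGING IS WLOG** (LINE 4's kernel form, `μ ↦ 2μ`): on a Δ²-closed support, weights `m ≥ 1` with (A1) and `μ ≠ 0` yield the
Δ²-INVARIANT weights `d2Avg m ≥ 1` with (A1) and `μ ≠ 0`. -/
theorem MConfig.d2Invariant_wlog (C : MConfig) (hl : D2Closed C.lower) (hu : D2Closed C.upper) (mN mP : MCell → ℤ)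
    (hN : ∀ Z ∈ C.lower, 0 < mN Z) (hP : ∀ P ∈ C.upper, 0 < mP P) (h : ClassScreen (C.wch mN mP)) (hμ : C.wch mN mP eWord ≠ 0) :
    (∀ Z, d2Avg mN Z.delta2 = d2Avg mN Z) ∧ (∀ P, d2Avg mP P.delta2 = d2Avg mP P) ∧
      (∀ Z ∈ C.lower, 0 < d2Avg mN Z) ∧ (∀ P ∈ C.upper, 0 < d2Avg mP P) ∧
      ClassScreen (C.wch (d2Avg mN) (d2Avg mP)) ∧ C.wch (d2Avg mN) (d2Avg mP) eWord ≠ 0 := by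
  refine ⟨d2Avg_delta2 mN, d2Avg_delta2 mP, d2Avg_pos hl hN, d2Avg_pos hu hP, C.classScreen_d2Avg hl hu mN mP h, ?_⟩
  rw [C.wch_d2Avg_eWord hl hu]
  exact mul_ne_zero (by decide) hμ

/-! ## §4 Dominance at design level: invariance under any non-trivial clean symmetry gives Δ²-invariance -/

/-- Δ-invariant weights are Δ²-invariant. -/
theorem d2Invariant_of_deltaInvariant (m : MCell → ℤ) (hm : ∀ Z, m Z.delta = m Z) (Z : MCell) : m Z.delta2 = m Z := by
  rw [MCell.delta2_eq_delta_delta, hm, hm]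

/-- γ_j-invariant weights are Δ²-invariant (`γ_j² = Δ²`). -/
theorem d2Invariant_of_gammaInvariant (j : Fin 3) (m : MCell → ℤ) (hm : ∀ Z, m (Z.phase (gVec j)) = m Z) (Z : MCell) :
    m Z.delta2 = m Z := by
  rw [MCell.delta2, ← torus_probes.1 j, MCell.phase_add, hm, hm]

/-- **weights invariant under a NON-TRIVIAL CLEAN SUBGROUP are Δ²-invariant** (`Δ² ∈ H` by `d2Sub_subset_of_cleanSub`) — LINE 4: «a support
closed under ANY non-trivial clean phase symmetry (Δ = row W14, the γ-cells = W14c (3), with or without permutations, the G₁ leg) is ⟨Δ²⟩-closed». -/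
theorem d2Invariant_of_cleanInvariant {H : Finset PVec} (hH : CleanSub H) (hne : H ≠ trivSub) (m : MCell → ℤ)
    (hm : ∀ η ∈ H, ∀ Z, m (Z.phase η) = m Z) (Z : MCell) : m Z.delta2 = m Z :=
  hm d2Vec (d2Sub_subset_of_cleanSub hH hne (by simp [d2Sub])) Z

/-- likewise for supports: closed under a non-trivial clean subgroup ⇒ Δ²-closed. -/
theorem d2Closed_of_cleanClosed {H : Finset PVec} (hH : CleanSub H) (hne : H ≠ trivSub) {S : Finset MCell}
    (hS : ∀ η ∈ H, PhaseClosed η S) : D2Closed S :=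
  hS d2Vec (d2Sub_subset_of_cleanSub hH hne (by simp [d2Sub]))

/-- **LINE 4's «640 ROWS PRE-PAID» FOR EVERY CLEAN-SYMMETRIC CELL**: on a support closed under a non-trivial clean subgroup `H` of `T`, with
`H`-invariant weights, every word with `n_e + n_ē` odd has `wch = 0` — rows W14 (⟨Δ⟩), W14b (⟨γ_j⟩), W14c, W14d alike. -/
theorem MConfig.wch_eq_zero_of_cleanInvariant {H : Finset PVec} (hH : CleanSub H) (hne : H ≠ trivSub) (C : MConfig)
    (hl : ∀ η ∈ H, PhaseClosed η C.lower) (hu : ∀ η ∈ H, PhaseClosed η C.upper) (mN mP : MCell → ℤ)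
    (hN : ∀ η ∈ H, ∀ Z, mN (Z.phase η) = mN Z) (hP : ∀ η ∈ H, ∀ P, mP (P.phase η) = mP P) (w : CWord) (hw : neCount w % 2 = 1) :
    C.wch mN mP w = 0 :=
  C.wch_eq_zero_of_d2Invariant (d2Closed_of_cleanClosed hH hne hl) (d2Closed_of_cleanClosed hH hne hu) mN mP
    (d2Invariant_of_cleanInvariant hH hne mN hN) (d2Invariant_of_cleanInvariant hH hne mP hP) w hw

/-! ## §5 `⟨Δ²⟩ × S₄`: the joint average (×48) is WLOG; the screen aggregation rule -/

/-- the Δ²-average of an S₄-invariant weight is S₄-invariant. -/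
theorem d2Avg_permInvariant (m : MCell → ℤ) (hm : ∀ σ Z, m (MCell.perm σ Z) = m Z) (σ : Equiv.Perm (Fin 4)) (Z : MCell) :
    d2Avg m (Z.perm σ) = d2Avg m Z := by
  simp only [d2Avg, MCell.delta2_perm, hm]

/-- the `⟨Δ²⟩ × S₄`-AVERAGE (×48): Δ²-average of the S₄-average. -/
def d2S4Avg (m : MCell → ℤ) : MCell → ℤ := d2Avg (permAvg m)

/-- the `⟨Δ²⟩ × S₄`-average multiplies the μ-word by `48 = |⟨Δ²⟩ × S₄|`. -/
theorem MConfig.wch_d2S4Avg_eWord (C : MConfig) (hl2 : D2Closed C.lower) (hu2 : D2Closed C.upper) (hl : PermClosed C.lower)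
    (hu : PermClosed C.upper) (mN mP : MCell → ℤ) : C.wch (d2S4Avg mN) (d2S4Avg mP) eWord = 48 * C.wch mN mP eWord := by
  rw [d2S4Avg, d2S4Avg, C.wch_d2Avg_eWord hl2 hu2, C.wch_permAvg_eWord hl hu]
  ring

/-- **`⟨Δ²⟩ × S₄`-AVERAGING IS WLOG** (LINE 4's kernel form, `μ ↦ 48μ`): on a support closed under Δ² AND under the 24 factor permutations,
weights `m ≥ 1` with (A1) and `μ ≠ 0` yield weights `d2S4Avg m ≥ 1` that are Δ²-INVARIANT and S₄-INVARIANT, satisfy (A1), and have `μ ≠ 0`. -/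
theorem MConfig.d2S4Invariant_wlog (C : MConfig) (hl2 : D2Closed C.lower) (hu2 : D2Closed C.upper) (hl : PermClosed C.lower)
    (hu : PermClosed C.upper) (mN mP : MCell → ℤ) (hN : ∀ Z ∈ C.lower, 0 < mN Z) (hP : ∀ P ∈ C.upper, 0 < mP P)
    (h : ClassScreen (C.wch mN mP)) (hμ : C.wch mN mP eWord ≠ 0) :
    (∀ Z, d2S4Avg mN Z.delta2 = d2S4Avg mN Z) ∧ (∀ σ Z, d2S4Avg mN (MCell.perm σ Z) = d2S4Avg mN Z) ∧
      (∀ P, d2S4Avg mP P.delta2 = d2S4Avg mP P) ∧ (∀ σ P, d2S4Avg mP (MCell.perm σ P) = d2S4Avg mP P) ∧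
      (∀ Z ∈ C.lower, 0 < d2S4Avg mN Z) ∧ (∀ P ∈ C.upper, 0 < d2S4Avg mP P) ∧
      ClassScreen (C.wch (d2S4Avg mN) (d2S4Avg mP)) ∧ C.wch (d2S4Avg mN) (d2S4Avg mP) eWord ≠ 0 := by
  obtain ⟨iN, iP, pN, pP, hA1, hμ'⟩ := C.permInvariant_wlog hl hu mN mP hN hP h hμ
  obtain ⟨dN, dP, qN, qP, hA1', hμ''⟩ := C.d2Invariant_wlog hl2 hu2 (permAvg mN) (permAvg mP) pN pP hA1 hμ'
  exact ⟨dN, fun σ Z => d2Avg_permInvariant _ iN σ Z, dP, fun σ P => d2Avg_permInvariant _ iP σ P, qN, qP, hA1', hμ''⟩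

/-- **THE SCREEN AGGREGATION RULE FOR `⟨Δ²⟩ × S₄`** (RESULT 15 (4), group-sum form): the sum of the class tensors over the 48 images
`σ·R`, `Δ²σ·R` of a cell, at the word `w`, is `(1 + (−1)^{n_e+n_ē})` times the sum over `σ` of `ch(R)` at the permuted words `σ·w` — zero at
odd words (the parity test), twice the S₄-aggregate at even words (rotations `{0, 2}`). -/
theorem groupSum_d2S4 (R : MCell) (w : CWord) :
    ∑ σ : Equiv.Perm (Fin 4), ((R.perm σ).ch w + (R.perm σ).delta2.ch w) =
      (1 + (-1) ^ neCount w) * ∑ σ : Equiv.Perm (Fin 4), R.ch (permW σ w) := by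
  have e : ∑ σ : Equiv.Perm (Fin 4), R.ch (permW σ w) = ∑ σ : Equiv.Perm (Fin 4), R.ch (permW σ⁻¹ w) :=
    (Fintype.sum_equiv (Equiv.inv (Equiv.Perm (Fin 4))) _ _ fun σ => rfl).symm
  rw [e, Finset.mul_sum]
  exact Finset.sum_congr rfl fun σ _ => by rw [MCell.ch_delta2, MCell.ch_perm]; ring

/-! ## §6 The γ-windows (card row W14b) -/

/-- `γ₁ = (i,i,−i,−i)` twists a word by `i^{twExp(w₀) + twExp(w₁) + 3(twExp(w₂) + twExp(w₃))}` = `i^{(n_e−n_ē)₀₁ − (n_e−n_ē)₂₃}`. -/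
theorem texp_gVec0 (w : CWord) : texp (gVec 0) w = twExp (w 0) + twExp (w 1) + 3 * twExp (w 2) + 3 * twExp (w 3) := by
  have h : (gVec 0 0).val = 1 ∧ (gVec 0 1).val = 1 ∧ (gVec 0 2).val = 3 ∧ (gVec 0 3).val = 3 := by decide
  simp only [texp, h.1, h.2.1, h.2.2.1, h.2.2.2]
  ring

/-- **THE γ-WINDOW COUNTS** (card W14b; gamma_counts.out «gamma (i,i,-i,-i): mixed rows surviving 198 of 1038 (of which Hermitian 70); FC pure-e
rows surviving 6 of 14», «a DIFFERENT 198 from Δ's»): for each of the three γ_j, of the 1 038 e-mixed words other than `eeee`, `ēēēē` exactly 840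
are γ_j-twisted (`texp ≢ 0 mod 4`) and 198 are not, 70 of the latter Hermitian (`n_e = n_ē`, i.e. `wtwExp ≡ 0 mod 4`: untwisted by Δ as well;
the other 128 of the 198 are Δ-twisted — gs-eng-2 g52 O1); and of the 14 pure `e∕ē` words exactly 6 are γ_j-untwisted, the same 6 that are Δ-untwisted
(the `(2e,2ē)` words). [kernel, `decide`] -/
theorem mixed_gamma_count :
    (∀ j : Fin 3, (univ.filter fun w : CWord => ¬ EFree w ∧ w ≠ eWord ∧ w ≠ ebarWord ∧ texp (gVec j) w % 4 ≠ 0).card = 840 ∧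
      (univ.filter fun w : CWord => ¬ EFree w ∧ w ≠ eWord ∧ w ≠ ebarWord ∧ texp (gVec j) w % 4 = 0).card = 198 ∧
      (univ.filter fun w : CWord => ¬ EFree w ∧ w ≠ eWord ∧ w ≠ ebarWord ∧ texp (gVec j) w % 4 = 0 ∧ wtwExp w % 4 = 0).card = 70 ∧
      (univ.filter fun w : CWord => (∀ f, w f = 3 ∨ w f = 4) ∧ w ≠ eWord ∧ w ≠ ebarWord ∧ texp (gVec j) w % 4 = 0).card = 6 ∧
      (univ.filter fun w : CWord => (∀ f, w f = 3 ∨ w f = 4) ∧ w ≠ eWord ∧ w ≠ ebarWord ∧ texp (gVec j) w % 4 = 0) =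
        (univ.filter fun w : CWord => (∀ f, w f = 3 ∨ w f = 4) ∧ w ≠ eWord ∧ w ≠ ebarWord ∧ wtwExp w % 4 = 0)) ∧
    (univ.filter fun w : CWord => ¬ EFree w ∧ w ≠ eWord ∧ w ≠ ebarWord ∧ texp (gVec 0) w % 4 = 0 ∧ wtwExp w % 4 = 0).card = 70 ∧
    (univ.filter fun w : CWord => (∀ f, w f = 3 ∨ w f = 4) ∧ w ≠ eWord ∧ w ≠ ebarWord).card = 14 := by
  refine ⟨fun j => ?_, by decide +kernel, by decide +kernel⟩
  fin_cases j <;> refine ⟨?_, ?_, ?_, ?_, ?_⟩ <;> decide +kernel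

/-- **A γ_j-INVARIANT DESIGN HAS EVERY γ_j-TWISTED WORD VANISH** («840 vanish identically» on γ-invariant designs; instance of §1). -/
theorem MConfig.wch_eq_zero_of_gammaInvariant (j : Fin 3) (C : MConfig) (hl : PhaseClosed (gVec j) C.lower)
    (hu : PhaseClosed (gVec j) C.upper) (mN mP : MCell → ℤ) (hN : ∀ Z, mN (Z.phase (gVec j)) = mN Z)
    (hP : ∀ P, mP (P.phase (gVec j)) = mP P) (w : CWord) (hw : texp (gVec j) w % 4 ≠ 0) : C.wch mN mP w = 0 :=
  C.wch_eq_zero_of_phaseInvariant (gVec j) hl hu mN mP hN hP w (by rw [twistT, Ne, gI_pow_eq_one_iff]; exact hw)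

/-! ## §7 Kernel probes -/

/-- on the four-phase fully charged cell `[ℓ₁|ℓ₋ᵢ|ℓ₋₁|ℓ_i]`: `Δ²` is the antipode on every factor (`ℓ_{i^k} ↦ ℓ_{i^{k+2}}`), differs from the
cell and from `Δ` of it, and its class tensor flips sign exactly at the odd words: `[e111]` (odd) flips, `[ee11]` and `eeee` (even) do not.
[kernel, `decide`] -/
theorem delta2_probe :
    fcCell.delta2 = mcellOf (lpt 1 2) (lpt 1 1) (lpt 1 0) (lpt 1 3) ∧ fcCell.delta2 ≠ fcCell ∧ fcCell.delta2 ≠ fcCell.delta ∧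
      fcCell.delta2.ch ![3, 0, 0, 0] = -fcCell.ch ![3, 0, 0, 0] ∧ fcCell.delta2.ch ![3, 3, 0, 0] = fcCell.ch ![3, 3, 0, 0] ∧
      fcCell.delta2.ch eWord = fcCell.ch eWord := by
  decide +kernel

end Summit.Ventures.HSemireg.Pad4Tower
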